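import Summits.AtomisticToContinuum.BoseEinsteinCondensation.Theorems.BECGroundStateSOSPeriodicIRBoundFsumDefs
import Summits.AtomisticToContinuum.BoseEinsteinCondensation.Theorems.BECGroundStateSOSPeriodicIRBoundFsumDCPotSlot
import Summits.AtomisticToContinuum.BoseEinsteinCondensation.Theorems.BECGroundStateSOSPeriodicIRBoundWFPotCross
import Summits.AtomisticToContinuum.BoseEinsteinCondensation.Theorems.BECGroundStateSOSPeriodicIRBoundWFPotCreate2
import Mathlib.Algebra.QuadraticDiscriminant
import HarnessLib

/-!
# Crux `PeriodicIRBound` (stmt-AtomisticToContinuum-3972), line `fsum-phase-pencil`, stub S3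
# `stub_phaseDoubleCommutator` — potential part, B: the pair form

The sesquilinear form `pairForm w L F G = ∫_{cell^{m+2}} w^per(x_0 − x_1) conj(F) G` of ONE pair (part A):
integrability of the pair weight against continuous functions (`∫ w^per(x_0 − x_1) ≤ ∫ W < ∞`),
sesquilinearity, hermiticity `conj(pairForm F G) = pairForm G F`, the diagonal as the weighted `ℝ≥0∞` integral
`Re pairForm F F = (∫ w^per |F|²).toReal ≥ 0`, and the Cauchy–Schwarz inequality
`(Re pairForm F G)² ≤ Re pairForm F F · Re pairForm G G` (registered by-product sub-goal `stub_fsumDCPotPair`).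
-/

noncomputable section

open MeasureTheory Filter
open scoped ENNReal NNReal ComplexConjugate BigOperators

namespace Summit.AtomisticToContinuum.BoseEinsteinCondensation.Cruxes.PeriodicIRBound.FsumPhasePencil

open Literature.MathematicalPhysics.QuantumManyBody.BoseGas
open Summit.AtomisticToContinuum.BoseEinsteinCondensation.Cruxes.PeriodicIRBound.LinearPhFloorWagner.WF

variable {N m n : ℕ} {L : ℝ}

/-! ## The pair weight `w^per(x_0 − x_1)`: integrability -/

section Weight

variable {w : ℝ → ℝ≥0∞}

/-- The pair weight is measurable. [folklore] -/
theorem measurable_pairWeight (hw : Measurable w) (L : ℝ) :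
    Measurable fun X : Config (m + 2) => periodizedPotential w L (X 0 - X 1) :=
  measurable_periodizedPotential_pair hw L 0 1

/-- The pair weight is integrable on the cell: `∫ w^per(x_0 − x_1) ≤ ∫ W < ∞`. [folklore] -/
theorem lintegral_pairWeight_ne_top (hL : 0 < L) (hw : Measurable w) (hint : (∫⁻ z : Space, w ‖z‖) ≠ ⊤) (m : ℕ) :
    (∫⁻ X in cellN (m + 2) L, periodizedPotential w L (X 0 - X 1)) ≠ ⊤ :=
  ne_top_of_le_ne_top (lintegral_cellN_periodicInteraction_ne_top hL hw hint (m + 2))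
    (lintegral_mono fun X => periodizedPotential_le_periodicInteraction w L X Fin.zero_lt_one)

/-- `X ↦ w^per(x_0 − x_1).toReal` is integrable on the cell (complex-valued). [folklore] -/
theorem integrable_pairWeight (hL : 0 < L) (hw : Measurable w) (hint : (∫⁻ z : Space, w ‖z‖) ≠ ⊤) (m : ℕ) :
    Integrable (fun X : Config (m + 2) => ((periodizedPotential w L (X 0 - X 1)).toReal : ℂ))
      (volume.restrict (cellN (m + 2) L)) :=
  (integrable_toReal_of_lintegral_ne_top (measurable_pairWeight hw L).aemeasurable
    (lintegral_pairWeight_ne_top hL hw hint m)).ofReal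

/-- `w^per(x_0 − x_1).toReal · H` is integrable on the cell for continuous `H`. [folklore] -/
theorem integrable_pairWeight_mul (hL : 0 < L) (hw : Measurable w) (hint : (∫⁻ z : Space, w ‖z‖) ≠ ⊤)
    {H : Config (m + 2) → ℂ} (hH : Continuous H) :
    Integrable (fun X : Config (m + 2) => ((periodizedPotential w L (X 0 - X 1)).toReal : ℂ) * H X)
      (volume.restrict (cellN (m + 2) L)) := by
  obtain ⟨C, -, hC⟩ := exists_bound_on_cellN L hH
  exact (integrable_pairWeight hL hw hint m).mul_bdd hH.aestronglyMeasurable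
    ((ae_restrict_mem (measurableSet_cellN (m + 2) L)).mono fun X hX => hC X hX)

/-- The integrand of the pair form is integrable for continuous arguments. [folklore] -/
theorem integrable_pairForm_integrand (hL : 0 < L) (hw : Measurable w) (hint : (∫⁻ z : Space, w ‖z‖) ≠ ⊤)
    {F G : Config (m + 2) → ℂ} (hF : Continuous F) (hG : Continuous G) :
    Integrable (fun X : Config (m + 2) => ((periodizedPotential w L (X 0 - X 1)).toReal : ℂ) * (conj (F X) * G X))
      (volume.restrict (cellN (m + 2) L)) :=
  integrable_pairWeight_mul hL hw hint ((Complex.continuous_conj.comp hF).mul hG)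

end Weight

/-! ## The pair form: sesquilinearity, hermiticity, positivity -/

section PairForm

variable {w : ℝ → ℝ≥0∞} (hL : 0 < L) (hw : Measurable w) (hint : (∫⁻ z : Space, w ‖z‖) ≠ ⊤)
include hL hw hint

/-- Additivity of the pair form in the first argument (continuous arguments). [folklore] -/
theorem pairForm_add_left {F G H : Config (m + 2) → ℂ} (hF : Continuous F) (hG : Continuous G) (hH : Continuous H) :
    pairForm w L (fun X => F X + G X) H = pairForm w L F H + pairForm w L G H := by
  unfold pairForm
  rw [← integral_add (integrable_pairForm_integrand hL hw hint hF hH) (integrable_pairForm_integrand hL hw hint hG hH)]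
  refine integral_congr_ae (Eventually.of_forall fun X => ?_)
  simp only [map_add]
  ring

/-- Additivity of the pair form in the second argument (continuous arguments). [folklore] -/
theorem pairForm_add_right {F G H : Config (m + 2) → ℂ} (hF : Continuous F) (hG : Continuous G) (hH : Continuous H) :
    pairForm w L F (fun X => G X + H X) = pairForm w L F G + pairForm w L F H := by
  unfold pairForm
  rw [← integral_add (integrable_pairForm_integrand hL hw hint hF hG) (integrable_pairForm_integrand hL hw hint hF hH)]
  refine integral_congr_ae (Eventually.of_forall fun X => ?_)
  simp only
  ring

omit hL hw hint in
/-- The pair form of `−F`. [folklore] -/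
theorem pairForm_neg_left (F G : Config (m + 2) → ℂ) :
    pairForm w L (fun X => -F X) G = -pairForm w L F G := by
  unfold pairForm
  rw [← integral_neg]
  refine integral_congr_ae (Eventually.of_forall fun X => ?_)
  simp only [map_neg]
  ring

omit hL hw hint in
/-- The pair form against `−G`. [folklore] -/
theorem pairForm_neg_right (F G : Config (m + 2) → ℂ) :
    pairForm w L F (fun X => -G X) = -pairForm w L F G := by
  unfold pairForm
  rw [← integral_neg]
  refine integral_congr_ae (Eventually.of_forall fun X => ?_)
  simp only
  ring

/-- The pair form of `F − G`. [folklore] -/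
theorem pairForm_sub_left {F G H : Config (m + 2) → ℂ} (hF : Continuous F) (hG : Continuous G) (hH : Continuous H) :
    pairForm w L (fun X => F X - G X) H = pairForm w L F H - pairForm w L G H := by
  simp only [sub_eq_add_neg]
  rw [pairForm_add_left hL hw hint hF hG.neg hH (G := fun X => -G X), pairForm_neg_left]

/-- The pair form against `G − H`. [folklore] -/
theorem pairForm_sub_right {F G H : Config (m + 2) → ℂ} (hF : Continuous F) (hG : Continuous G) (hH : Continuous H) :
    pairForm w L F (fun X => G X - H X) = pairForm w L F G - pairForm w L F H := by
  simp only [sub_eq_add_neg]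
  rw [pairForm_add_right hL hw hint hF hG hH.neg (H := fun X => -H X), pairForm_neg_right]

omit hL hw hint in
/-- Conjugate-homogeneity in the first argument. [folklore] -/
theorem pairForm_const_mul_left (c : ℂ) (F G : Config (m + 2) → ℂ) :
    pairForm w L (fun X => c * F X) G = conj c * pairForm w L F G := by
  unfold pairForm
  rw [← integral_const_mul]
  refine integral_congr_ae (Eventually.of_forall fun X => ?_)
  simp only [map_mul]
  ring

omit hL hw hint in
/-- Homogeneity in the second argument. [folklore] -/
theorem pairForm_const_mul_right (c : ℂ) (F G : Config (m + 2) → ℂ) :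
    pairForm w L F (fun X => c * G X) = c * pairForm w L F G := by
  unfold pairForm
  rw [← integral_const_mul]
  refine integral_congr_ae (Eventually.of_forall fun X => ?_)
  simp only
  ring

/-- The pair form of a finite sum in the first argument. [folklore] -/
theorem pairForm_finset_sum_left {ι : Type*} (s : Finset ι) {F : ι → Config (m + 2) → ℂ} {H : Config (m + 2) → ℂ}
    (hF : ∀ i ∈ s, Continuous (F i)) (hH : Continuous H) :
    pairForm w L (fun X => ∑ i ∈ s, F i X) H = ∑ i ∈ s, pairForm w L (F i) H := by
  classical
  induction s using Finset.induction_on with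
  | empty => simp [pairForm]
  | @insert i s hi ih =>
    have hFs : ∀ i' ∈ s, Continuous (F i') := fun i' hi' => hF i' (Finset.mem_insert_of_mem hi')
    simp only [Finset.sum_insert hi]
    rw [pairForm_add_left hL hw hint (hF i (Finset.mem_insert_self i s)) (continuous_finsetSum s hFs) hH, ih hFs]

/-- The pair form of a finite sum in the second argument. [folklore] -/
theorem pairForm_finset_sum_right {ι : Type*} (s : Finset ι) {F : Config (m + 2) → ℂ} {H : ι → Config (m + 2) → ℂ}
    (hF : Continuous F) (hH : ∀ i ∈ s, Continuous (H i)) :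
    pairForm w L F (fun X => ∑ i ∈ s, H i X) = ∑ i ∈ s, pairForm w L F (H i) := by
  classical
  induction s using Finset.induction_on with
  | empty => simp [pairForm]
  | @insert i s hi ih =>
    have hHs : ∀ i' ∈ s, Continuous (H i') := fun i' hi' => hH i' (Finset.mem_insert_of_mem hi')
    simp only [Finset.sum_insert hi]
    rw [pairForm_add_right hL hw hint hF (hH i (Finset.mem_insert_self i s)) (continuous_finsetSum s hHs), ih hHs]

omit hL hw hint in
/-- **Hermiticity**: `conj(pairForm F G) = pairForm G F` (the weight is real). [folklore] -/
theorem conj_pairForm (F G : Config (m + 2) → ℂ) : conj (pairForm w L F G) = pairForm w L G F := by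
  unfold pairForm
  rw [← integral_conj]
  refine integral_congr_ae (Eventually.of_forall fun X => ?_)
  simp only [map_mul, Complex.conj_ofReal, Complex.conj_conj]
  ring

omit hL hw hint in
/-- `Re pairForm F G = Re pairForm G F`. [folklore] -/
theorem pairForm_re_comm (F G : Config (m + 2) → ℂ) : (pairForm w L F G).re = (pairForm w L G F).re := by
  rw [← conj_pairForm F G, Complex.conj_re]

/-- **The diagonal of the pair form** is the weighted `ℝ≥0∞` integral:
`Re pairForm F F = (∫ w^per(x_0 − x_1) ‖F‖²).toReal` for continuous `F`. [folklore] -/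
theorem pairForm_self_re {F : Config (m + 2) → ℂ} (hF : Continuous F) :
    (pairForm w L F F).re =
      (∫⁻ X in cellN (m + 2) L, periodizedPotential w L (X 0 - X 1) * ((‖F X‖₊ : ℝ≥0∞)) ^ 2).toReal := by
  unfold pairForm
  have hi := integrable_pairForm_integrand hL hw hint hF hF
  have hre := integral_re hi
  simp only [RCLike.re_to_complex] at hre
  rw [← hre]
  have hpt : ∀ X : Config (m + 2), (((periodizedPotential w L (X 0 - X 1)).toReal : ℂ) * (conj (F X) * F X)).re =
      (periodizedPotential w L (X 0 - X 1)).toReal * ‖F X‖ ^ 2 := fun X => by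
    rw [Complex.conj_mul', ← Complex.ofReal_pow, ← Complex.ofReal_mul, Complex.ofReal_re]
  simp_rw [hpt]
  have hsm : AEStronglyMeasurable (fun X : Config (m + 2) => (periodizedPotential w L (X 0 - X 1)).toReal * ‖F X‖ ^ 2)
      (volume.restrict (cellN (m + 2) L)) :=
    ((measurable_pairWeight hw L).ennreal_toReal.mul (hF.norm.pow 2).measurable).aestronglyMeasurable
  rw [integral_eq_lintegral_of_nonneg_ae (Eventually.of_forall fun X => by positivity) hsm]
  congr 1
  refine lintegral_congr_ae ?_
  filter_upwards [ae_restrict_iff' (measurableSet_cellN (m + 2) L) |>.2 (Eventually.of_forall fun X _ => trivial),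
    ae_lt_top' (measurable_pairWeight hw L).aemeasurable.restrict (lintegral_pairWeight_ne_top hL hw hint m)] with X _ hX
  rw [ENNReal.ofReal_mul ENNReal.toReal_nonneg, ENNReal.ofReal_toReal hX.ne, coe_nnnorm_sq_eq_ofReal]

/-- `0 ≤ Re pairForm F F`. [folklore] -/
theorem pairForm_self_re_nonneg {F : Config (m + 2) → ℂ} (hF : Continuous F) : 0 ≤ (pairForm w L F F).re := by
  rw [pairForm_self_re hL hw hint hF]
  exact ENNReal.toReal_nonneg

/-- **Cauchy–Schwarz for the pair form** (real part): `(Re pairForm F G)² ≤ Re pairForm F F · Re pairForm G G`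
(the real quadratic `t ↦ Re pairForm (F + tG) (F + tG) ≥ 0`). [folklore] -/
theorem pairForm_re_sq_le {F G : Config (m + 2) → ℂ} (hF : Continuous F) (hG : Continuous G) :
    (pairForm w L F G).re ^ 2 ≤ (pairForm w L F F).re * (pairForm w L G G).re := by
  have key : ∀ t : ℝ, 0 ≤ (pairForm w L G G).re * (t * t) + 2 * (pairForm w L F G).re * t + (pairForm w L F F).re := by
    intro t
    have htG : Continuous fun X => (t : ℂ) * G X := continuous_const.mul hG
    have hFt : Continuous fun X => F X + (t : ℂ) * G X := hF.add htG
    have h0 := pairForm_self_re_nonneg hL hw hint hFt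
    rw [pairForm_add_left hL hw hint hF htG hFt, pairForm_add_right hL hw hint hF hF htG,
      pairForm_add_right hL hw hint htG hF htG, pairForm_const_mul_left, pairForm_const_mul_left,
      pairForm_const_mul_right, pairForm_const_mul_right, Complex.conj_ofReal] at h0
    simp only [Complex.add_re, Complex.re_ofReal_mul, pairForm_re_comm G F] at h0
    nlinarith [h0]
  have hdisc := discrim_le_zero key
  rw [discrim] at hdisc
  nlinarith [hdisc]

/-- `|Re pairForm F G| ≤ √(Re pairForm F F) √(Re pairForm G G)`. [folklore] -/
theorem abs_pairForm_re_le {F G : Config (m + 2) → ℂ} (hF : Continuous F) (hG : Continuous G) :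
    |(pairForm w L F G).re| ≤ Real.sqrt ((pairForm w L F F).re) * Real.sqrt ((pairForm w L G G).re) := by
  rw [← Real.sqrt_mul (pairForm_self_re_nonneg hL hw hint hF)]
  exact Real.abs_le_sqrt (pairForm_re_sq_le hL hw hint hF hG)

end PairForm

/-! ## Registered headline -/

/-- **Registered by-product sub-goal `stub_fsumDCPotPair`** (line `fsum-phase-pencil`, helper of S3
`stub_phaseDoubleCommutator`): Cauchy–Schwarz for the pair form, `pairForm_re_sq_le`. [folklore] -/
theorem stub_fsumDCPotPair : ∀ {m : ℕ} {L : ℝ} {w : ℝ → ℝ≥0∞}, 0 < L → Measurable w → (∫⁻ z : Space, w ‖z‖) ≠ ⊤ → ∀ {F G : Config (m + 2) → ℂ}, Continuous F → Continuous G → (pairForm w L F G).re ^ 2 ≤ (pairForm w L F F).re * (pairForm w L G G).re :=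
  fun hL hw hint _ _ hF hG => pairForm_re_sq_le hL hw hint hF hG

end Summit.AtomisticToContinuum.BoseEinsteinCondensation.Cruxes.PeriodicIRBound.FsumPhasePencil

end
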